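import Summits.SmoothPoincare4.SmoothPoincare4.Theorems.SullivanDualWitnessChargeHelperMemberSlab
import Summits.SmoothPoincare4.SmoothPoincare4.Theorems.SullivanDualWitnessChargeHelperMemberGraphFunction
import Summits.SmoothPoincare4.SmoothPoincare4.Theorems.SullivanDualWitnessChargeFlatChart
import Mathlib.Analysis.Complex.Basic

/-!
# Helper `helper_memberUniform_of` of line `Sketch` for crux `WitnessCharge`
(item stmt-SmoothPoincare4-7824; route `SullivanDual`, crux
`Summit.SmoothPoincare4.SmoothPoincare4.Theses.SullivanDual.WitnessCharge`; line `Sketch`,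
registered stub `helper_memberUniform_of` of the lead's cycle-2 helper skeleton — (N)-branch,
uniform control of pencil members of bounded intercept on compact discs)

**Uniform avoidance of a punctured ball.** Let `J` be STANDARD on the punctured `ε'`-chart-ball
`B_{ε'}` at `p` (closed `ε'`-ball inside the chart target). ASSUME the near bound (the neighbour
`helper_memberNearBound_of`, taken here as a hypothesis): for every pencil member `u` of intercept
`b`, every `R > ε'⁻¹`, `r ≥ 2R` and `‖ξ‖ ≤ r` with `u ξ ∈ B_{ε'}` one has `‖(Ycoord p (u ξ)).1‖ ≤ 2r`.
THEN for all `B, r` there is `0 < η ≤ ε'` such that every pencil member `u` of intercept `‖b‖ ≤ B`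
maps the disc `‖ξ‖ ≤ r` OUTSIDE the punctured `η`-chart-ball `B_η`.

Proof. Put `R = ε'⁻¹ + 1`, `r' = max r (2R)`, `W = max ε'⁻¹ B`, `M = 2r' + W + 1 > 0` and
`η = min ε' M⁻¹`. If `‖ξ‖ ≤ r` and `u ξ ∈ B_η ⊆ B_{ε'}`, then `‖(Ycoord p (u ξ)).1‖ ≤ 2r'` (near
bound) and `‖(Ycoord p (u ξ)).2‖ ≤ max ε'⁻¹ ‖b‖ ≤ W` (landed slab bound `helper_memberSlab`), so
`‖realify (Ycoord p (u ξ))‖ ≤ 2r' + W < M` (`norm_realify_sq`). But on `B_η` one has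
`‖realify (Ycoord p x)‖ = ‖e x − e p‖⁻¹ > η⁻¹ ≥ M` (`Ycoord_mem_stdEnd`) — contradiction.
-/

noncomputable section

-- the registered namespace `Summit.SmoothPoincare4.SmoothPoincare4.…` repeats a component
set_option linter.dupNamespace false

open scoped Manifold ContDiff Topology
open Set Filter Literature.Geometry.Kaehler Literature.Geometry.Symplectic
  Literature.Topology.FourManifolds

namespace Summit.SmoothPoincare4.SmoothPoincare4.Theorems.WitnessCharge.PencilIncompleteness

/-- The Euclidean norm of the realification is at most the sum of the norms of the two complex
components: `‖realify q‖ ≤ ‖q.1‖ + ‖q.2‖` (from `‖realify q‖² = ‖q.1‖² + ‖q.2‖²`). -/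
theorem norm_realify_le_add (q : ℂ × ℂ) : ‖realify q‖ ≤ ‖q.1‖ + ‖q.2‖ := by
  refine le_of_pow_le_pow_left₀ two_ne_zero (add_nonneg (norm_nonneg _) (norm_nonneg _)) ?_
  rw [norm_realify_sq]
  nlinarith [norm_nonneg q.1, norm_nonneg q.2]

/-- On the punctured `η`-chart-ball with `0 < η ≤ M⁻¹`, `0 < M`, the realified flat coordinate has
norm `> M`: `‖realify (Ycoord p x)‖ = ‖e x − e p‖⁻¹ > η⁻¹ ≥ M`. -/
theorem lt_norm_realify_Ycoord_of_ball {S : HomotopySphere 4} {p : S.carrier} {η M : ℝ}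
    (hη : 0 < η) (hM : 0 < M) (hηM : η ≤ M⁻¹) {x : punctured p}
    (hx : InPuncturedChartBall p η x) : M < ‖realify (Ycoord p x)‖ := by
  have h1 : η⁻¹ < ‖realify (Ycoord p x)‖ := Ycoord_mem_stdEnd hη hx
  have h2 : M ≤ η⁻¹ := (le_inv_comm₀ hM hη).2 hηM
  exact h2.trans_lt h1

/-- **Uniform avoidance for members of bounded intercept (N-branch helper).** For `J` standard on
the punctured `ε'`-chart-ball at `p` (closed `ε'`-ball inside the chart target), GIVEN the near
bound `‖(Ycoord p (u ξ)).1‖ ≤ 2r` for pencil members on discs `‖ξ‖ ≤ r`, `r ≥ 2R`, `R > ε'⁻¹`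
(hypothesis; the neighbour `helper_memberNearBound_of`), for all `B, r` there is `0 < η ≤ ε'` such
that every pencil member `u` of intercept `‖b‖ ≤ B` maps the disc `‖ξ‖ ≤ r` outside the punctured
`η`-chart-ball: with `r' = max r (2(ε'⁻¹ + 1))`, `W = max ε'⁻¹ B`, `M = 2r' + W + 1`,
`η = min ε' M⁻¹`, a point `u ξ ∈ B_η` with `‖ξ‖ ≤ r` would have
`M < ‖realify (Ycoord p (u ξ))‖ ≤ ‖(Ycoord p (u ξ)).1‖ + ‖(Ycoord p (u ξ)).2‖ ≤ 2r' + W < M`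
(near bound, slab bound `helper_memberSlab`, `norm_realify_sq`, `Ycoord_mem_stdEnd`). -/
theorem helper_memberUniform_of :
    (∀ (S : HomotopySphere 4) (p : S.carrier)
      (J : ∀ x : punctured p, TangentSpace (𝓡 4) x →L[ℝ] TangentSpace (𝓡 4) x) (ε' : ℝ)
      (u : ℂ → punctured p) (b : ℂ),
      0 < ε' →
      Metric.closedBall (extChartAt (𝓡 4) p p) ε' ⊆ (extChartAt (𝓡 4) p).target →
      (∀ x : punctured p, InPuncturedChartBall p ε' x →
        ∀ (v : TangentSpace (𝓡 4) x) (b : EuclideanSpace ℝ (Fin 4)),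
          inner ℝ (fderiv ℝ inversion (extChartAt (𝓡 4) p x.1 - extChartAt (𝓡 4) p p)
            (mfderiv (𝓡 4) 𝓘(ℝ, EuclideanSpace ℝ (Fin 4))
              (fun z : punctured p => extChartAt (𝓡 4) p z.1) x (J x v))) b
          = stdSymplecticForm (fderiv ℝ inversion (extChartAt (𝓡 4) p x.1 - extChartAt (𝓡 4) p p)
            (mfderiv (𝓡 4) 𝓘(ℝ, EuclideanSpace ℝ (Fin 4))
              (fun z : punctured p => extChartAt (𝓡 4) p z.1) x v)) b) →
      IsPencilMember J u b →
      ∀ R : ℝ, ε'⁻¹ < R → ∀ r : ℝ, 2 * R ≤ r → ∀ ξ : ℂ, ‖ξ‖ ≤ r →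
        InPuncturedChartBall p ε' (u ξ) → ‖(Ycoord p (u ξ)).1‖ ≤ 2 * r) →
    ∀ (S : HomotopySphere 4) (p : S.carrier)
      (J : ∀ x : punctured p, TangentSpace (𝓡 4) x →L[ℝ] TangentSpace (𝓡 4) x) (ε' : ℝ),
      0 < ε' →
      Metric.closedBall (extChartAt (𝓡 4) p p) ε' ⊆ (extChartAt (𝓡 4) p).target →
      (∀ x : punctured p, InPuncturedChartBall p ε' x →
        ∀ (v : TangentSpace (𝓡 4) x) (b : EuclideanSpace ℝ (Fin 4)),
          inner ℝ (fderiv ℝ inversion (extChartAt (𝓡 4) p x.1 - extChartAt (𝓡 4) p p)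
            (mfderiv (𝓡 4) 𝓘(ℝ, EuclideanSpace ℝ (Fin 4))
              (fun z : punctured p => extChartAt (𝓡 4) p z.1) x (J x v))) b
          = stdSymplecticForm (fderiv ℝ inversion (extChartAt (𝓡 4) p x.1 - extChartAt (𝓡 4) p p)
            (mfderiv (𝓡 4) 𝓘(ℝ, EuclideanSpace ℝ (Fin 4))
              (fun z : punctured p => extChartAt (𝓡 4) p z.1) x v)) b) →
      ∀ B r : ℝ, ∃ η : ℝ, 0 < η ∧ η ≤ ε' ∧
        ∀ (u : ℂ → punctured p) (b : ℂ), IsPencilMember J u b → ‖b‖ ≤ B →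
          ∀ ξ : ℂ, ‖ξ‖ ≤ r → ¬ InPuncturedChartBall p η (u ξ) := by
  intro hnear S p J ε' hε' hball hJstd B r
  -- the constants `R = ε'⁻¹ + 1`, `r' = max r (2R)`, `W = max ε'⁻¹ B`, `M = 2r' + W + 1`
  have hinv : 0 < ε'⁻¹ := inv_pos.2 hε'
  obtain ⟨R, hR, hRpos⟩ : ∃ R : ℝ, ε'⁻¹ < R ∧ 0 < R :=
    ⟨ε'⁻¹ + 1, lt_add_one _, add_pos hinv one_pos⟩
  obtain ⟨r', hrr', hRr'⟩ : ∃ r' : ℝ, r ≤ r' ∧ 2 * R ≤ r' :=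
    ⟨max r (2 * R), le_max_left _ _, le_max_right _ _⟩
  obtain ⟨W, hεW, hBW⟩ : ∃ W : ℝ, ε'⁻¹ ≤ W ∧ B ≤ W :=
    ⟨max ε'⁻¹ B, le_max_left _ _, le_max_right _ _⟩
  obtain ⟨M, hM⟩ : ∃ M : ℝ, M = 2 * r' + W + 1 := ⟨_, rfl⟩
  have hMpos : 0 < M := by rw [hM]; linarith
  refine ⟨min ε' M⁻¹, lt_min hε' (inv_pos.2 hMpos), min_le_left _ _, ?_⟩
  intro u b hmem hbB ξ hξ hin
  -- `u ξ` lies in the larger ball `B_{ε'}` as well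
  have hin' : InPuncturedChartBall p ε' (u ξ) :=
    ⟨hin.1, Metric.ball_subset_ball (min_le_left _ _) hin.2⟩
  -- the two flat coordinates are bounded: near bound and slab bound
  have h1 : ‖(Ycoord p (u ξ)).1‖ ≤ 2 * r' :=
    hnear S p J ε' u b hε' hball hJstd hmem R hR r' hRr' ξ (hξ.trans hrr') hin'
  have h2 : ‖(Ycoord p (u ξ)).2‖ ≤ W :=
    (helper_memberSlab S p J ε' u b hε' hball hJstd hmem ξ hin').trans
      (max_le hεW (hbB.trans hBW))
  -- but on `B_η` the realified flat coordinate has norm `> M`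
  have h3 : M < ‖realify (Ycoord p (u ξ))‖ :=
    lt_norm_realify_Ycoord_of_ball (lt_min hε' (inv_pos.2 hMpos)) hMpos (min_le_right _ _) hin
  have h4 := norm_realify_le_add (Ycoord p (u ξ))
  linarith

end Summit.SmoothPoincare4.SmoothPoincare4.Theorems.WitnessCharge.PencilIncompleteness
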